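import Summits.BirchSwinnertonDyer.Rank1Residual.X11b.BDPRouteStatement
import Summits.BirchSwinnertonDyer.Rank1Residual.X11b.TwistTransportUnit
import Summits.BirchSwinnertonDyer.Rank1Residual.X11b.TwistTransportIrr
import HarnessLib

/-!
# Class X11b, route "BDP + converse-theorem engine + Kolyvagin": the sub-cell target modulo STEP L, the Manin-unit datum and the Tamagawa transport (cell `b2b-bsdres`, sub-cell `multr1-p2`)

HONEST FRAMING (cell `b2b-bsdres`, run/shared/lean/b2b/bsd-rank1-residual/, verbatim in every
file): the goal of the cell is to DELETE the COMBINATION-SHAPED residual classes of the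
Birch–Swinnerton-Dyer formula for ALL analytic-rank `≤ 1` elliptic curves over `ℚ` — "full BSD
formula for every rank `≤ 1` curve in class `C`" assembled STRICTLY from published theorems — so
that the rank-`≤ 1` remainder becomes exactly the CONSTRUCTION-SHAPED classes, which are TYPED
(missing-input `Prop`s), NOT attempted. This is not "finishing BSD". Sub-cell `multr1-p2` is a
RESEARCH ROUTE on class X11b; no claim beyond the stated class and locus; X11b's label does not
change.

THEOREMS ONLY (no definition, no new named fact). `bsdp_of_classX11b_of_locus_of_tamagawaTransport`:
the sub-cell target "for every `(E,p)` in X11b with `p ≥ 5`, a (ram) prime and `p ∤ ∏_ℓ c_ℓ(E)`: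
Miller's `BSD(E,p)`" (= `X11b.Statement`) from (i) the route's ONE typed input STEP L
(`IndexLowerBoundAt` at every Heegner datum with Manin constant prime to `p`; OPEN at `p ∥ N`, see
`X11b/BDPRoute.lean`), (ii) PUBLISHED tree facts (Gross–Zagier, Kolyvagin 1990 ×2, Skinner 2016
Thm. C, Gross–Zagier–Kolyvagin over `ℚ`, modularity ×2, the Friedberg–Hoffstein field, `w_K = 2` for
`d_K < −4`), and (iii) TWO explicit transport binders, each a routine published fact not yet a tree
theorem: `hMan` (a Heegner point of a parametrisation datum with Manin constant prime to `p` at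
`p ∥ N`, `p ≥ 5`, `E[p]` irreducible — Gross 1984 + Mazur 1978 Cor. 4.1 / Abbes–Ullmo 1996 along a
prime-to-`p` isogeny) and `hTam` (for `K` with every `ℓ ∣ N` split and every globally minimal model
`Wd` of `E^{d_K}`: `ord_p ∏_ℓ c_ℓ(Wd) = ord_p ∏_ℓ c_ℓ(W)` — Jetchev–Skinner–Wan 2017 (eq:tamK),
Kodaira–Néron). The other transports are THEOREMS of the tree: multiplicative reduction at `p` and the
(ram) prime (`TwistTransport.lean`, `TwistTransportRam.lean`), the `p`-unit scaling
(`TwistTransportUnit.lean`), irreducibility of the twist's `p`-torsion (`TwistTransportIrr.lean`).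

References: [JetchevSkinnerWan2017] §7.3.1, §7.4; [Skinner2016PacificMC] Thm. C;
[KolyvaginEulerSystems1990] Thm. A; [FriedbergHoffstein1995]; [Miller2011LMS] Def. 1.1.
-/

noncomputable section

open scoped Classical

open WeierstrassCurve NumberField Literature.NumberTheory.EllipticCurves
  Literature.NumberTheory.EllipticCurves.ModularForms
  Literature.NumberTheory.EllipticCurves.Rank1Residual

namespace Summit.BirchSwinnertonDyer.Rank1Residual.X11b


/-- **The sub-cell target from STEP L, the Manin-unit datum and ONE remaining transport ((d) the
`p`-part of the Tamagawa product of the twist).** Same as `bsdp_of_classX11b_of_locus_of_transport`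
(`X11b/BDPRouteStatement.lean`), with multiplicative reduction at `p`, the (ram) prime, the `p`-unit
scaling (`TwistTransport*.lean`) and the irreducibility of `Wd[p]` all DERIVED (`TwistTransportIrr.hasIrreducibleModPGaloisRep_twist_model`:
`E^{d_K}[p] ≅ E[p] ⊗ χ`, `d_K` not a rational square). What the binder `hTam` still asks, for every
globally minimal model `Wd = Cd • W^{(d_K)}`: `ord_p ∏_ℓ c_ℓ(Wd) = ord_p ∏_ℓ c_ℓ(W)`
(Jetchev–Skinner–Wan 2017 §7.3.1 (eq:tamK): equal at the split `ℓ ∣ N`, `≤ 4 < p` at `ℓ ∣ d_K` by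
Kodaira–Néron, `1` elsewhere). CONDITIONAL on STEP L; X11b's label unchanged.
[cite: JetchevSkinnerWan2017, §7.3.1 (eq:tamK) and §7.4.1 (pp. 29–31)]
[cite: Skinner2016PacificMC, Thm. C (§1)] [cite: Miller2011LMS, Def. 1.1] -/
theorem bsdp_of_classX11b_of_locus_of_tamagawaTransport
    -- published inputs (named facts of the tree)
    (hGZ : ∀ (N : ℕ) [NeZero N] (W : WeierstrassCurve ℚ) (K : Type) [Field K] [NumberField K],
      gross_zagier N W K)
    (hKo : ∀ (N : ℕ) [NeZero N] (W : WeierstrassCurve ℚ) (K : Type) [Field K] [NumberField K],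
      kolyvagin N W K)
    (hB : ∀ (N : ℕ) [NeZero N] (W : WeierstrassCurve ℚ) (K : Type) [Field K] [NumberField K],
      Kolyvagin1990_padicValNat_card_sha_le N W K)
    (hSk : Skinner2016.thmC_padicValRat_bsd_rank_zero)
    (hGZK : rank_eq_analyticRank_of_analyticRank_le_one) (hmod : hasEntireLFunction_rat)
    (hnf : exists_isNewformOf)
    (hFH : friedbergHoffstein_exists_heegnerField_split_twist_ne_zero)
    -- transport package 1: a Heegner point of a datum with Manin constant prime to `p`
    (hMan : ∀ (W : WeierstrassCurve ℚ) [W.IsElliptic] [W.IsGloballyMinimal] (p : ℕ) [Fact p.Prime]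
      (N : ℕ) [NeZero N] (K : Type) [Field K] [NumberField K],
      W.conductorNorm ℤ = N → 5 ≤ p → W.HasMultiplicativeReductionAtPrime p →
      W.HasIrreducibleModPGaloisRep p → IsImaginaryQuadratic K → SatisfiesHeegnerHypothesis N K →
      ∃ (Dt : ModularParametrizationData W N) (H : HeegnerDatum N (NumberField.discr K))
        (ι : K →+* ℂ) (P : (W.baseChange K).toAffine.Point),
        WeierstrassCurve.Affine.Point.map ι.toRatAlgHom P = heegnerPointComplex Dt H ∧
          ¬ (p : ℤ) ∣ Dt.c)
    -- transport (d): every globally minimal model of the twist has the same `p`-part of `∏ c_ℓ`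
    (hTam : ∀ (W : WeierstrassCurve ℚ) [W.IsElliptic] [W.IsGloballyMinimal] (p : ℕ) [Fact p.Prime]
      (K : Type) [Field K] [NumberField K] (Wd : WeierstrassCurve ℚ) [Wd.IsElliptic]
      [Wd.IsGloballyMinimal] (Cd : VariableChange ℚ),
      5 ≤ p → IsImaginaryQuadratic K → SatisfiesHeegnerHypothesis (W.conductorNorm ℤ) K →
      W.HasMultiplicativeReductionAtPrime p → W.HasIrreducibleModPGaloisRep p →
      Cd • W.quadraticTwist (NumberField.discr K : ℚ) = Wd →
      padicValNat p Wd.tamagawaProduct = padicValNat p W.tamagawaProduct)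
    -- the typed input of the route (STEP L), at every Heegner datum with Manin constant prime to `p`
    (hL : ∀ (W : WeierstrassCurve ℚ) [W.IsElliptic] [W.IsGloballyMinimal] (p : ℕ) [Fact p.Prime]
      (N : ℕ) [NeZero N] (K : Type) [Field K] [NumberField K]
      (Dt : ModularParametrizationData W N) (H : HeegnerDatum N (NumberField.discr K)) (ι : K →+* ℂ)
      (P : (W.baseChange K).toAffine.Point),
      ClassX11b W p → Locus W p → W.conductorNorm ℤ = N → IsImaginaryQuadratic K →
      SatisfiesHeegnerHypothesis N K →
      WeierstrassCurve.Affine.Point.map ι.toRatAlgHom P = heegnerPointComplex Dt H →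
      ¬ (p : ℤ) ∣ Dt.c → IndexLowerBoundAt W p K P) :
    ∀ (W : WeierstrassCurve ℚ) [W.IsElliptic] [W.IsGloballyMinimal] (p : ℕ) [Fact p.Prime],
      ClassX11b W p → Locus W p → BSDp W p := by
  refine bsdp_of_classX11b_of_locus_of_transport hGZ hKo hB hSk hGZK hmod hnf hFH hMan ?_ hL
  intro W _ _ p _ K _ _ Wd _ _ Cd hp5 hK hH hmult hirr hWd
  exact ⟨hasIrreducibleModPGaloisRep_twist_model W p K hK.1 hirr Cd hWd,
    hTam W p K Wd Cd hp5 hK hH hmult hirr hWd,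
    padicValRat_u_eq_zero_of_twist_minimal W p K hK hH hmult Cd hWd⟩

end Summit.BirchSwinnertonDyer.Rank1Residual.X11b

end
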